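import Literature.MathematicalPhysics.QuantumFieldTheory.Balaban1983to89.B8Eq1122Local
import Literature.MathematicalPhysics.QuantumFieldTheory.Balaban1983to89.B8Eq1117Concrete
import Literature.MathematicalPhysics.QuantumFieldTheory.Balaban1983to89.B8Eq106Local

/-!
# `Balaban1983to89.B8Eq1117KLevel` — [Balaban1985RegularSpaces] Sect. E pp. 95–97 AT `k` LEVELS: the fixed-point equation
# (1.117) «C′(λ − H′X) = X» / the transformation (1.118) on print's `X : 𝔅_k → 𝔤`, `𝔅_k = ⋃_j Λ_j`, its unique solvability «by the
# contraction mapping theorem», and the self-map bound (1.121), FOR THE INDUCTIVE `u₁` OF THEOREM 4 OVER A NESTED PAIR `(Ω, Λ)` WITH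
# REGION-DEPENDENT (tower-local) HYPOTHESES — the form «on Ω_j, j = 0, …, k» that p05's one-level `B8Eq1117Concrete` left NOT CLAIMED

statement-level skeleton of published theorems with citation tags; proofs where landed; nothing here is a claim about the Yang–Mills mass gap

T. Bałaban, *Spaces of regular gauge field configurations on a lattice and gauge fixing conditions*, Commun.
Math. Phys. **99** (1985) 75–102 `[Balaban1985RegularSpaces]` ("B8"; printed page = PDF page + 74), pp. 95–97 [PDF 21–23];
[3] = [Balaban1985Averaging], Prop. 10 (203)–(214) p. 50.  PDF held: `paper:balaban1985-cmp99-regular-spaces-gauge-fixing`.  STATUS: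
published, refereed.

CITATION HEADER (lean-in-tree rule).  Cell `pub-ymgap` (YM Track A, DAG node N05 = [B8], HUMAN RULING D-0062), seat
`pub-ymgap-dag-n05-b`, gen 0; dag-lead assignment «Thm 4 chain, Sect. E at k levels» (display split with `pub-ymgap-dag-n04-b`).  WHAT IS
REPRODUCED = SKELETON rows **B8.Eq1.113** ((1.117)–(1.121)) / **B8.Claim@97** («exactly one solution of Eq. (1.117)») in the
REGION-DEPENDENT form: the tree's `B8Eq1117Concrete.eq1117_existsUnique` (p05) is the one-level version (`pdev U₀ < α₀L^{−2k}` and (1.119)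
GLOBALLY with the weight `L⁻ᵏ`, `u₁ ∈ Λ_k(U₀, α₃)` globally, `C′` read at ALL sites; its NOT CLAIMED: «the region-dependent form on
{Ω_j}»).  Here `X` ranges over the same complete space `B8Eq1117Concrete.XSpace d k 𝔸` (all `(j, z)`, `j ≤ k`), the equation is read on
`𝔅_k = {(j, y) : y ∈ Λ_j}` ONLY («configurations X : 𝔅_k → 𝔤», p. 95; `X = 0` off `𝔅_k`), and every hypothesis is TOWER-LOCAL per
`(j, y ∈ Λ_j)` in the currency of dag-n04-b's `B8Eq1115Concrete` / `B8Eq106Local` and this seat's `B8Eq1122Local`: (1.33) for `U₀` on the fine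
block `Bʲ(y)`, (1.69) `|B_b| ≤ cL^{−j}` there, (1.119) for `λ` there with the scale `L^{−j}`, the (1.92)/(1.120)-type modulus of the ABSTRACT
`H′` there, and `u₁ = glev_j` on `Bʲ(y)` (= (106) of [3], dag-n04-b's `B8Eq106Local.eq106_local`).  INPUTS BY NAME (nothing restated):
`B8Eq1115Concrete.eq214_local_B8` ((1.121) local, dag-n04-b), `B8Eq1122Local.lipschitz1122_local` ((1.122)/(1.125) local, this seat),
`B8Eq1115Concrete.utilG_congr_tower` (locality of `C′` in `u₁`), `B8SectDSource.fixedPoint_closedBall` (Banach, r05),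
`B8Eq1122Concrete.cjDiff_sub`, `B8Eq1123Concrete.Cnl`, `B8Ineq125Concrete.C2p`.  Kind «kernel-checked proof», theorems only: no `def`
(the transformation (1.118) is a `let` inside the proof; the statement reads the fixed point POINTWISE), no `… : Prop` fact, no existing
module modified.

## THE PRINTED TEXT (pp. 95–97 [PDF 21–23])

«We want to construct a function D′(λ) for α₃, α₄ sufficiently small, whose values are configurations X : 𝔅_k → 𝔤, such that the
transformation λ′ = λ − H′D′(λ) (1.113) changes the function Q′(λ′) into the linear function Q′λ … The function D′(λ) is a solution of
the equation C′(λ − H′X) = X, (1.117) or a fixed point of the transformation X → C′(λ − H′X). (1.118) … Let us assume that |λ| < ½α₄,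
|Dλ| < ½α₄(Lʲη)⁻¹ on Ω_j, |X| < α₄/(2B′₀). (1.119)  This implies |λ − H′X| < α₄, |D(λ − H′X)| < α₄(Lʲη)⁻¹ on Ω_j, (1.120) and by the
inequality (214) we have |C′(λ − H′X)| < C′₂(α₃ + α₄)α₄, (1.121) … The transformation (1.118) maps the set (1.119) of X's into itself if
C′₂(α₃ + α₄)α₄ ≦ α₄/(2B′₀) … the mapping (1.118) is contractive if e.g. α₃ + α₄ ≦ 1/(4B′₀C′₂). … Thus by the contraction
mapping theorem there exists exactly one solution of Eq. (1.117).»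

## WHAT IS CERTIFIED HERE (kernel; axioms `propext` / `Classical.choice` / `Quot.sound`)

Setting: `ℤᵈ` carriers; `𝔸` complete normed `ℂ`-algebra, `‖1‖ = 1`; `L ≥ 2`, `G ⊂ U1` averaging-closed, `U₀` `G`-valued; `U₁ = e^{B}`;
a gauge transformation `u₁` (Theorem 4's inductive one); the constraint sites `Λ : ℕ → Set (Site d)` (`Λ_j` = sites of the `j`-lattice;
print's `𝔅_k = ⋃_{j ≤ k} Λ_j`); `λ : ℤᵈ → 𝔸`; `H′ : XSpace →ₗ[ℂ] (ℤᵈ → 𝔸)` abstract.  Hypotheses per `(j, y)`, `j ≤ k`, `y ∈ Λ_j`, ON THE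
TOWER `[tlo L y j, thi L y j] = Bʲ(y)` ONLY: (1.33) `pdevOn … U₀ < α₀L^{−2j}`; (1.69) `|B_b| ≤ cL^{−j}`; `u₁ = glev L _ U₀ e^{B} j 0`; (1.119)
`‖λ(x)‖ < ½α₄`, `‖R(U₀(b))λ(b₊) − λ(b₋)‖ < ½α₄L^{−j}`; `‖R(U₀(b))(H′X)(b₊) − (H′X)(b₋)‖ ≤ B′₀‖X‖L^{−j}`; and globally `‖(H′X)(x)‖ ≤ B′₀‖X‖`.
Smallness: `B8Eq1115Concrete.eq214_local_B8`'s and `B8Eq1122Local.lipschitz1122_local`'s at `2α₄` (READING (c) of p05: (214) on the doubled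
domain), and print's «α₃ + α₄ ≦ 1/(4B′₀C′₂)» with `α₃ = 40d·c`, `C′₂ := 2·C2p d`.
* §1 `dom120_of_119_tower` — (1.119) ⇒ (1.120) on the tower for `λ − H′X`, `‖X‖ ≤ α₄/(2B′₀)`.
* §2 `Cnl_congr_u1_tower` — `C′_{m′}(u₁, μ)(z)` on the tower under `y` depends on `u₁` only through `u₁|_{Bʲ(y)}` (dag-n04-b's
  `utilG_congr_tower`); `norm_Cnl_le_tower` — **(1.121) AT `(j, y ∈ Λ_j)`**: `‖C′_j(u₁, λ − H′X)(y)‖ ≤ C′₂(α₃ + α₄)α₄` (from `eq214_local_B8`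
  at the top of the tower); `lipschitz_Cnl_tower` — the Lipschitz sentence at `(j, y)` with modulus `B′₀‖X₁ − X₂‖` (from
  `lipschitz1122_local`).
* §3 **`eq1117_existsUnique_kLevel`** — «by the contraction mapping theorem there exists exactly one solution of Eq. (1.117)» AT `k`
  LEVELS: there is EXACTLY ONE `X` in the closed ball `‖X‖ ≤ α₄/(2B′₀)` of `XSpace d k 𝔸` with `X(j, y) = C′_j(u₁, λ − H′X)(y)` for
  `y ∈ Λ_j` and `X(j, y) = 0` for `y ∉ Λ_j` (`j ≤ k`).
* §4 `eq1114_of_fixedPoint_kLevel` — (1.114) from (1.115)–(1.117) on `𝔅_k` (algebra: (213) + linearity of `Q′_j` + `Q′H′ = I` on `𝔅_k`);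
  `norm_Dprime_le_kLevel` — «|D′(λ)| = |C′(λ − H′D′(λ))| < C′₂(α₃ + α₄)α₄» for any solution in the ball vanishing off `𝔅_k`;
  **`exists_Dprime_kLevel`** — «We take D′(λ) equal to this solution»: an `X = D′(λ)` in the ball with `‖X‖ ≤ C2p(α₃ + α₄)α₄`, `0` off
  `𝔅_k`, solving (1.117) on `𝔅_k`, with (1.114) `Q′_j(u₁, λ − H′X)(y) = (Q′_jλ)(y)` on `𝔅_k`.
* §5 `glev_on_towers_of_axial`, **`exists_Dprime_kLevel_of_axial`** — the same for THE inductive `u₁`: the hypothesis `u₁ = glev_j on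
  Bʲ(Λ_j)` discharged from `InAx` ((1.19)/(1.34) for `U₁^{u₁}U₀`) and `Restr129` ((1.29)/(1.68)) by dag-n04-b's
  `B8Eq106Local.eq106_of_inAx_restr129`.

## HONEST SCOPE / LOCATED READING — what is NOT claimed

(i) Constants, windows, the `½α₄`/`2α₄` and `C′₂ := 2·C2p` bookkeeping are EXACTLY p05's (`B8Eq1117Concrete` READINGS (a)–(e), cell GAPS
G-B8-17) and dag-n04-b's (`40d` for print's `16d`); only the quantifiers of the hypotheses shrink to the towers over `Λ_j`.  (ii) `X` is read
on `𝔅_k` (print) — off `Λ_j` the fixed point is `0` by definition of the masked transformation; the closed ball `≤` replaces print's open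
set (uniqueness domain only larger), as in p05.  (iii) `u₁ = glev_j on Bʲ(y)` is a HYPOTHESIS in §2–§4 and is DISCHARGED in §5 from
(1.19)/(1.29), i.e. `InAx`/`Restr129` (dag-n04-b's `eq106_of_inAx_restr129`).  (iv) `H′` abstract with level-dependent modulus bounds (the lattice `H′` of (1.91) and `B′₀` of
(1.92) = interface I-B8-2 / in-edge b9).  (v) `Q′H′ = I` on `𝔅_k` is a HYPOTHESIS on the abstract `H′` ((1.91)).  (vi) NOT HERE: `D′` as an (analytic / Lipschitz) FUNCTION
of `λ`, the onto sentence of p. 97, analyticity (1.123)/(1.124) (dag-n04-b's file 6) — next modules.  Nothing here is progress on the summit.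
-/

noncomputable section

open NormedSpace Finset

namespace Literature.MathematicalPhysics.QuantumFieldTheory.Balaban1983to89.B8Eq1117KLevel

open B7Prop1Explicit B7Prop2Explicit B7Prop3Flat B7Prop1Local B7Eq167Flat B7Eq167General
open B7Eq170Flat (cj cj_apply)
open B7Prop10General (C6 C4G)
open B7Prop10Flat (one_le_C5 C4'_nonneg C5'_nonneg)
open B7Prop9Flat (C5')
open B7Eq214General (Cgen)
open B8Ineq130 (tlo thi inBox_of_le tlo_zero thi_zero)
open B7Eq84Concrete (glev)
open B8Eq1115Concrete (utilG_congr_tower lamAvgG_congr_tower eq214_local_B8)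
open B7Eq78Linearization (zdBlocking QprimeIter)
open B8Eq119TwistedAxial (bgT)
open B8Eq178Averages (Qnl Qnl_eq_mlog_utilG qprimeIter_bgT_eq_lamAvgG)
open B8Eq1123Concrete (Cnl QprimeIter_line)
open B8Ineq125Concrete (C2p C2p_nonneg)
open B8Eq1122Concrete (cjDiff_sub)
open B8Eq1117Concrete (XSpace)
open B8Eq1122Local (lipschitz1122_local)
open B8Ineq132 (Under)
open B8Eq119TwistedAxial (InAx Restr129)
open B8Eq106Local (eq106_of_inAx_restr129 under_iff_tower)
open B7Eq92Concrete (mgauge)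

-- `Site` alone could resolve to the torus sites of `Setup.lean`; re-export the `ℤ^d` sites of `B7Prop1Explicit`.
export B7Prop1Explicit (Site)

variable {d : ℕ}

/-! ## §1 (1.119) ⇒ (1.120) on a tower for `λ − H′X`, with `H′` abstract -/

section Dom

variable {𝔸 : Type*} [NormedRing 𝔸] [NormedAlgebra ℂ 𝔸]

/-- **(1.119) ⇒ (1.120) ON THE TOWER `Bʲ(y)`** for `μ = λ − H′X`, `‖X‖ ≤ α₄/(2B′₀)`: from `λ` in the half-size set on the tower (scale
`s = L^{−j}`), `‖(H′X)(x)‖ ≤ B′₀‖X‖` and the tower modulus bound `‖R(U₀(b))(H′X)(b₊) − (H′X)(b₋)‖ ≤ B′₀‖X‖s` there: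
`‖μ(x)‖ < α₄` at the sites and `‖R(U₀(b))μ(b₊) − μ(b₋)‖ < α₄s` on the bonds of the tower. [cite: Balaban1985RegularSpaces, (1.119)–(1.120) p.96] -/
theorem dom120_of_119_tower {k : ℕ} {U₀ : Site d → Fin d → 𝔸ˣ} (H' : XSpace d k 𝔸 →ₗ[ℂ] (Site d → 𝔸)) {B₀' α₄ s : ℝ}
    {lo hi : Site d} (hB : 0 < B₀') (hs : 0 ≤ s)
    (hH0 : ∀ (X : XSpace d k 𝔸) (x : Site d), ‖H' X x‖ ≤ B₀' * ‖X‖)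
    (hH1 : ∀ (X : XSpace d k 𝔸) (x : Site d) (κ : Fin d), InBox lo hi x → InBox lo hi (x + e κ) →
      ‖cj (U₀ x κ) (H' X (x + e κ)) - H' X x‖ ≤ B₀' * ‖X‖ * s)
    {lam : Site d → 𝔸}
    (h119a : ∀ (x : Site d) (κ : Fin d), InBox lo hi x → InBox lo hi (x + e κ) →
      ‖cj (U₀ x κ) (lam (x + e κ)) - lam x‖ < α₄ / 2 * s)
    (h119b : ∀ x : Site d, InBox lo hi x → ‖lam x‖ < α₄ / 2)
    {X : XSpace d k 𝔸} (hX : ‖X‖ ≤ α₄ / (2 * B₀')) :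
    (∀ (x : Site d) (κ : Fin d), InBox lo hi x → InBox lo hi (x + e κ) →
        ‖cj (U₀ x κ) ((lam - H' X) (x + e κ)) - (lam - H' X) x‖ < α₄ * s) ∧
      ∀ x : Site d, InBox lo hi x → ‖(lam - H' X) x‖ < α₄ := by
  have hBX : B₀' * ‖X‖ ≤ α₄ / 2 := by
    calc B₀' * ‖X‖ ≤ B₀' * (α₄ / (2 * B₀')) := mul_le_mul_of_nonneg_left hX hB.le
      _ = α₄ / 2 := by field_simp
  refine ⟨fun x κ hx hxe => ?_, fun x hx => ?_⟩
  · rw [cjDiff_sub]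
    calc ‖cj (U₀ x κ) (lam (x + e κ)) - lam x - (cj (U₀ x κ) (H' X (x + e κ)) - H' X x)‖
        ≤ ‖cj (U₀ x κ) (lam (x + e κ)) - lam x‖ + ‖cj (U₀ x κ) (H' X (x + e κ)) - H' X x‖ := norm_sub_le _ _
      _ ≤ ‖cj (U₀ x κ) (lam (x + e κ)) - lam x‖ + B₀' * ‖X‖ * s := by gcongr; exact hH1 X x κ hx hxe
      _ ≤ ‖cj (U₀ x κ) (lam (x + e κ)) - lam x‖ + α₄ / 2 * s := by gcongr
      _ < α₄ / 2 * s + α₄ / 2 * s := by linarith [h119a x κ hx hxe]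
      _ = α₄ * s := by ring
  · calc ‖(lam - H' X) x‖ = ‖lam x - H' X x‖ := rfl
      _ ≤ ‖lam x‖ + ‖H' X x‖ := norm_sub_le _ _
      _ ≤ ‖lam x‖ + B₀' * ‖X‖ := by gcongr; exact hH0 X x
      _ < α₄ / 2 + α₄ / 2 := by linarith [h119b x hx]
      _ = α₄ := by ring

end Dom

/-! ## §2 (1.121) and the Lipschitz sentence at one point `(j, y)` of `𝔅_k`, for an arbitrary `u₁` agreeing with `glev_j` on `Bʲ(y)` -/

section Point

variable {𝔸 : Type*} [NormedRing 𝔸] [NormOneClass 𝔸] [NormedAlgebra ℂ 𝔸] [CompleteSpace 𝔸]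
variable {L : ℕ} {G : Subgroup 𝔸ˣ} {j : ℕ} {y : Site d} {U₀ : Site d → Fin d → 𝔸ˣ} {α₀ α₄ : ℝ} {B : Site d → Fin d → 𝔸} {c : ℝ}
  {u₁ : Site d → 𝔸ˣ}

omit [NormOneClass 𝔸] in
/-- **Locality of `C′_{m′}(u₁, μ)` in the gauge transformation**: two `u₁`'s equal on the sites of `Bʲ(y)` give the same `C′_{m′}(u₁, μ)(z)`
at every level-`m′` site `z` of `Bⁿ(y)`, `n + m′ = j` (dag-n04-b's `utilG_congr_tower` at a fixed background).
[cite: Balaban1985Averaging, p.24 (after (43)), (178)–(179) p.45; Balaban1985RegularSpaces, (1.115) p.96] -/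
theorem Cnl_congr_u1_tower (hL1 : 1 ≤ L) {u₁ u₁' : Site d → 𝔸ˣ}
    (hu : ∀ x : Site d, tlo L y j ≤ x → x ≤ thi L y j → u₁ x = u₁' x) (μ : Site d → 𝔸)
    {m' n : ℕ} (hmn : n + m' = j) (z : Site d) (hz : tlo L y n ≤ z) (hz' : z ≤ thi L y n) :
    Cnl L U₀ u₁ m' μ z = Cnl L U₀ u₁' m' μ z := by
  have h₀ : AgreeOn (tlo L y j) (thi L y j) U₀ U₀ := fun _ _ _ _ => rfl
  simp only [Cnl, Qnl_eq_mlog_utilG]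
  rw [utilG_congr_tower hL1 h₀ (fun _ _ _ => rfl) hu m' n hmn z hz hz']

/-- **(1.121) AT THE POINT `(j, y)` OF `𝔅_k`** for an arbitrary `u₁` with `u₁ = glev_j` on `Bʲ(y)`: under the tower-local hypotheses of
`B8Eq1115Concrete.eq214_local_B8` ((1.33) on `Bʲ(y)`, (1.69) `|B_b| ≤ cL^{−j}`, (1.120) for `μ` at scale `L^{−j}`, the `j`-free smallness),
`‖C′_j(u₁, μ)(y)‖ ≤ C2p·(α₃ + α₄)·α₄` with `α₃ = 40d·c`. [cite: Balaban1985RegularSpaces, (1.121) p.96; Balaban1985Averaging, (214) p.50] -/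
theorem norm_Cnl_le_tower (hL : 2 ≤ L) (hG : AvgClosed d L G) (hU₀ : ∀ x κ, U₀ x κ ∈ G)
    (hα : 0 < α₀) (hα3 : C0 d * α₀ ≤ 1 / 3) (hα4 : 4 * α₀ ≤ c2' d L)
    (h33 : pdevOn (tlo L y j) (thi L y j) U₀ < α₀ * (((L : ℝ) ^ j)⁻¹) ^ 2) (hc : 0 ≤ c)
    (h69 : ∀ (x : Site d) (κ : Fin d), InBox (tlo L y j) (thi L y j) x → InBox (tlo L y j) (thi L y j) (x + e κ) →
      ‖B x κ‖ ≤ c * ((L : ℝ) ^ j)⁻¹)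
    (hsmall : Real.exp (4 * (800 * ((d : ℝ) + 1) ^ 2 * ((d : ℝ) + 4)) * α₀) * (1 + 8 * (131072 * ((d : ℝ) + 1) ^ 2) * c) ≤ 2)
    (hc₃ : 2 * c ≤ c3 d L) (hs : 128 * (d : ℝ) * c ≤ 1) (hL1 : 1 ≤ L)
    (hu₁ : ∀ x : Site d, tlo L y j ≤ x → x ≤ thi L y j → u₁ x = glev L hL1 U₀ (expCfg B) j 0 x)
    (hα₄ : 0 < α₄) {μ : Site d → 𝔸}
    (hμb : ∀ x : Site d, InBox (tlo L y j) (thi L y j) x → ‖μ x‖ < α₄)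
    (hμa : ∀ (x : Site d) (κ : Fin d), InBox (tlo L y j) (thi L y j) x → InBox (tlo L y j) (thi L y j) (x + e κ) →
      ‖cj (U₀ x κ) (μ (x + e κ)) - μ x‖ < α₄ * ((L : ℝ) ^ j)⁻¹)
    (hα₃' : 40 * d * c ≤ 1 / 200) (hs₁ : 200 * C6 d * α₄ ≤ 1) (hs₂ : 12000 * ((d : ℝ) + 1) * L * α₄ ≤ 1)
    (hs₃ : C4G d L * (α₀ + 40 * d * c + 4 * α₄) ≤ 1)
    (hs₄ : 1024 * ((d : ℝ) + 1) * ((d : ℝ) + 4) * L ^ 2 * α₀ ≤ 1) (hs₅ : 32 * ((d : ℝ) + 1) ^ 2 * C6 d * L ^ 2 * α₀ ≤ 1)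
    (hs₆ : 16 * d * C5' d * C6 d * (L : ℝ) ^ 2 * α₀ ≤ 1) (hs₇ : 8 * d * C6 d * L * α₀ ≤ 1) :
    ‖Cnl L U₀ u₁ j μ y‖ ≤ C2p d * (40 * d * c + α₄) * α₄ := by
  have hy : tlo L y 0 ≤ y := by rw [tlo_zero]
  have hy' : y ≤ thi L y 0 := by rw [thi_zero]
  rw [Cnl_congr_u1_tower hL1 hu₁ μ (m' := j) (n := 0) (by omega) y hy hy']
  have h := eq214_local_B8 hL hG hU₀ hα hα3 hα4 h33 hc h69 hsmall hc₃ hs hL1 hα₄ hμb hμa hα₃' hs₁ hs₂ hs₃ hs₄ hs₅ hs₆ hs₇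
    (m := j) (n := 0) (by omega) y hy hy'
  have hLj : (0 : ℝ) < (L : ℝ) ^ j := by positivity
  have e : (L : ℝ) ^ j * ((L : ℝ) ^ j)⁻¹ = 1 := mul_inv_cancel₀ hLj.ne'
  rw [e, mul_one] at h
  refine h.trans_eq ?_
  simp only [C2p]
  ring

/-- **THE LIPSCHITZ SENTENCE AT THE POINT `(j, y)` OF `𝔅_k`** for an arbitrary `u₁` with `u₁ = glev_j` on `Bʲ(y)`: under the tower-local
hypotheses of `B8Eq1122Local.lipschitz1122_local` (two `μ`'s in the half-size set at scale `L^{−j}` with difference modulus `m`),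
`‖C′_j(u₁, μ₁)(y) − C′_j(u₁, μ₂)(y)‖ ≤ C2p·2m·(α₃ + α₄)`. [cite: Balaban1985RegularSpaces, (1.122)–(1.125) pp.96–97] -/
theorem lipschitz_Cnl_tower (hL : 2 ≤ L) (hG : AvgClosed d L G) (hU₀ : ∀ x κ, U₀ x κ ∈ G)
    (hα : 0 < α₀) (hα3 : C0 d * α₀ ≤ 1 / 3) (hα4 : 4 * α₀ ≤ c2' d L)
    (h33 : pdevOn (tlo L y j) (thi L y j) U₀ < α₀ * (((L : ℝ) ^ j)⁻¹) ^ 2) (hc : 0 ≤ c)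
    (h69 : ∀ (x : Site d) (κ : Fin d), InBox (tlo L y j) (thi L y j) x → InBox (tlo L y j) (thi L y j) (x + e κ) →
      ‖B x κ‖ ≤ c * ((L : ℝ) ^ j)⁻¹)
    (hsmall : Real.exp (4 * (800 * ((d : ℝ) + 1) ^ 2 * ((d : ℝ) + 4)) * α₀) * (1 + 8 * (131072 * ((d : ℝ) + 1) ^ 2) * c) ≤ 2)
    (hc₃ : 2 * c ≤ c3 d L) (hs : 128 * (d : ℝ) * c ≤ 1) (hL1 : 1 ≤ L)
    (hu₁ : ∀ x : Site d, tlo L y j ≤ x → x ≤ thi L y j → u₁ x = glev L hL1 U₀ (expCfg B) j 0 x)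
    (hα₄ : 0 < α₄) {μ₁ μ₂ : Site d → 𝔸} {m : ℝ} (hm : 0 ≤ m)
    (h₁b : ∀ x : Site d, InBox (tlo L y j) (thi L y j) x → ‖μ₁ x‖ < α₄ / 2)
    (h₁a : ∀ (x : Site d) (κ : Fin d), InBox (tlo L y j) (thi L y j) x → InBox (tlo L y j) (thi L y j) (x + e κ) →
      ‖cj (U₀ x κ) (μ₁ (x + e κ)) - μ₁ x‖ < α₄ / 2 * ((L : ℝ) ^ j)⁻¹)
    (h₂b : ∀ x : Site d, InBox (tlo L y j) (thi L y j) x → ‖μ₂ x‖ < α₄ / 2)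
    (h₂a : ∀ (x : Site d) (κ : Fin d), InBox (tlo L y j) (thi L y j) x → InBox (tlo L y j) (thi L y j) (x + e κ) →
      ‖cj (U₀ x κ) (μ₂ (x + e κ)) - μ₂ x‖ < α₄ / 2 * ((L : ℝ) ^ j)⁻¹)
    (hmb : ∀ x : Site d, InBox (tlo L y j) (thi L y j) x → ‖(μ₁ - μ₂) x‖ ≤ m)
    (hma : ∀ (x : Site d) (κ : Fin d), InBox (tlo L y j) (thi L y j) x → InBox (tlo L y j) (thi L y j) (x + e κ) →
      ‖cj (U₀ x κ) ((μ₁ - μ₂) (x + e κ)) - (μ₁ - μ₂) x‖ ≤ m * ((L : ℝ) ^ j)⁻¹)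
    (hα₃' : 40 * d * c ≤ 1 / 200) (hs₁ : 200 * C6 d * α₄ ≤ 1) (hs₂ : 12000 * ((d : ℝ) + 1) * L * α₄ ≤ 1)
    (hs₃ : C4G d L * (α₀ + 40 * d * c + 4 * α₄) ≤ 1)
    (hs₄ : 1024 * ((d : ℝ) + 1) * ((d : ℝ) + 4) * L ^ 2 * α₀ ≤ 1) (hs₅ : 32 * ((d : ℝ) + 1) ^ 2 * C6 d * L ^ 2 * α₀ ≤ 1)
    (hs₆ : 16 * d * C5' d * C6 d * (L : ℝ) ^ 2 * α₀ ≤ 1) (hs₇ : 8 * d * C6 d * L * α₀ ≤ 1) :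
    ‖Cnl L U₀ u₁ j μ₁ y - Cnl L U₀ u₁ j μ₂ y‖ ≤ C2p d * (2 * m) * (40 * d * c + α₄) := by
  have hy : tlo L y 0 ≤ y := by rw [tlo_zero]
  have hy' : y ≤ thi L y 0 := by rw [thi_zero]
  rw [Cnl_congr_u1_tower hL1 hu₁ μ₁ (m' := j) (n := 0) (by omega) y hy hy',
    Cnl_congr_u1_tower hL1 hu₁ μ₂ (m' := j) (n := 0) (by omega) y hy hy']
  have h := lipschitz1122_local hL hG hU₀ hα hα3 hα4 h33 hc h69 hsmall hc₃ hs hL1 hα₄ hm h₁b h₁a h₂b h₂a hmb hma hα₃' hs₁ hs₂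
    hs₃ hs₄ hs₅ hs₆ hs₇ (m' := j) (n := 0) (by omega) y hy hy'
  have hLj : (0 : ℝ) < (L : ℝ) ^ j := by positivity
  have e : (L : ℝ) ^ j * ((L : ℝ) ^ j)⁻¹ = 1 := mul_inv_cancel₀ hLj.ne'
  rw [e, mul_one] at h
  exact h

end Point

/-! ## §3 «exactly one solution of Eq. (1.117)» at `k` levels -/

section FixedPoint

variable {𝔸 : Type*} [NormedRing 𝔸] [NormOneClass 𝔸] [NormedAlgebra ℂ 𝔸] [CompleteSpace 𝔸]

/-- **«BY THE CONTRACTION MAPPING THEOREM THERE EXISTS EXACTLY ONE SOLUTION OF Eq. (1.117)» AT `k` LEVELS** (p. 97), region-dependent form: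
for the constraint sites `Λ_j` (`j ≤ k`; `𝔅_k = ⋃_j Λ_j`), tower-local hypotheses at every `(j, y ∈ Λ_j)` — (1.33) for `U₀` on `Bʲ(y)`,
(1.69) `|B_b| ≤ cL^{−j}` there, `u₁ = glev_j` there, (1.119) for `λ` there at scale `L^{−j}`, the tower modulus of `H′` there — the global
bound `‖(H′X)(x)‖ ≤ B′₀‖X‖`, the `j`-free smallness (at `2α₄`, p05's READING (c)) and print's «α₃ + α₄ ≦ 1/(4B′₀C′₂)» (`α₃ = 40d·c`,
`C′₂ := 2·C2p d`): there is EXACTLY ONE `X ∈ XSpace d k 𝔸` with `‖X‖ ≤ α₄/(2B′₀)` such that for all `j ≤ k`, `y`: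
`X(j, y) = C′_j(u₁, λ − H′X)(y)` if `y ∈ Λ_j` and `X(j, y) = 0` if `y ∉ Λ_j` — (1.117) on `𝔅_k`.
[cite: Balaban1985RegularSpaces, (1.117)–(1.121) pp.96–97, p.97 (contraction, exactly one solution)] -/
theorem eq1117_existsUnique_kLevel {L : ℕ} (hL : 2 ≤ L) (hL1 : 1 ≤ L) {G : Subgroup 𝔸ˣ} (hG : AvgClosed d L G)
    {U₀ : Site d → Fin d → 𝔸ˣ} (hU₀ : ∀ x κ, U₀ x κ ∈ G) {k : ℕ} (Λ : ℕ → Set (Site d))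
    (H' : XSpace d k 𝔸 →ₗ[ℂ] (Site d → 𝔸)) (lam : Site d → 𝔸) {B : Site d → Fin d → 𝔸} {u₁ : Site d → 𝔸ˣ}
    {α₀ α₄ c B₀' : ℝ}
    (hα : 0 < α₀) (hα3 : C0 d * α₀ ≤ 1 / 3) (hα4 : 4 * α₀ ≤ c2' d L) (hc : 0 ≤ c) (hα₄ : 0 < α₄) (hB : 0 < B₀')
    (h33 : ∀ j, j ≤ k → ∀ y ∈ Λ j, pdevOn (tlo L y j) (thi L y j) U₀ < α₀ * (((L : ℝ) ^ j)⁻¹) ^ 2)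
    (h69 : ∀ j, j ≤ k → ∀ y ∈ Λ j, ∀ (x : Site d) (κ : Fin d), InBox (tlo L y j) (thi L y j) x →
      InBox (tlo L y j) (thi L y j) (x + e κ) → ‖B x κ‖ ≤ c * ((L : ℝ) ^ j)⁻¹)
    (hu₁ : ∀ j, j ≤ k → ∀ y ∈ Λ j, ∀ x : Site d, tlo L y j ≤ x → x ≤ thi L y j → u₁ x = glev L hL1 U₀ (expCfg B) j 0 x)
    (h119b : ∀ j, j ≤ k → ∀ y ∈ Λ j, ∀ x : Site d, InBox (tlo L y j) (thi L y j) x → ‖lam x‖ < α₄ / 2)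
    (h119a : ∀ j, j ≤ k → ∀ y ∈ Λ j, ∀ (x : Site d) (κ : Fin d), InBox (tlo L y j) (thi L y j) x →
      InBox (tlo L y j) (thi L y j) (x + e κ) → ‖cj (U₀ x κ) (lam (x + e κ)) - lam x‖ < α₄ / 2 * ((L : ℝ) ^ j)⁻¹)
    (hH0 : ∀ (X : XSpace d k 𝔸) (x : Site d), ‖H' X x‖ ≤ B₀' * ‖X‖)
    (hH1 : ∀ j, j ≤ k → ∀ y ∈ Λ j, ∀ (X : XSpace d k 𝔸) (x : Site d) (κ : Fin d), InBox (tlo L y j) (thi L y j) x →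
      InBox (tlo L y j) (thi L y j) (x + e κ) → ‖cj (U₀ x κ) (H' X (x + e κ)) - H' X x‖ ≤ B₀' * ‖X‖ * ((L : ℝ) ^ j)⁻¹)
    (hsmall : Real.exp (4 * (800 * ((d : ℝ) + 1) ^ 2 * ((d : ℝ) + 4)) * α₀) * (1 + 8 * (131072 * ((d : ℝ) + 1) ^ 2) * c) ≤ 2)
    (hc₃ : 2 * c ≤ c3 d L) (hs : 128 * (d : ℝ) * c ≤ 1) (hα₃' : 40 * d * c ≤ 1 / 200)
    (hs₁ : 200 * C6 d * (2 * α₄) ≤ 1) (hs₂ : 12000 * ((d : ℝ) + 1) * L * (2 * α₄) ≤ 1)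
    (hs₃ : C4G d L * (α₀ + 40 * d * c + 4 * (2 * α₄)) ≤ 1)
    (hs₄ : 1024 * ((d : ℝ) + 1) * ((d : ℝ) + 4) * L ^ 2 * α₀ ≤ 1) (hs₅ : 32 * ((d : ℝ) + 1) ^ 2 * C6 d * L ^ 2 * α₀ ≤ 1)
    (hs₆ : 16 * d * C5' d * C6 d * (L : ℝ) ^ 2 * α₀ ≤ 1) (hs₇ : 8 * d * C6 d * L * α₀ ≤ 1)
    (hsm : 40 * d * c + α₄ ≤ 1 / (4 * B₀' * (2 * C2p d))) :
    ∃! X : XSpace d k 𝔸, ‖X‖ ≤ α₄ / (2 * B₀') ∧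
      ∀ (j : ℕ) (hj : j ≤ k) (y : Site d),
        (y ∈ Λ j → X (⟨j, Nat.lt_succ_of_le hj⟩, y) = Cnl L U₀ u₁ j (lam - H' X) y) ∧
          (y ∉ Λ j → X (⟨j, Nat.lt_succ_of_le hj⟩, y) = 0) := by
  classical
  have hC2 : 0 ≤ C2p d := C2p_nonneg d
  have hC2pos : 0 < C2p d := by
    have hC6 : (2 : ℝ) ≤ C6 d := by unfold C6; linarith [one_le_C5 (d := d)]
    unfold C2p Cgen; positivity
  have hρ : 0 ≤ α₄ / (2 * B₀') := by positivity
  have hα₃ : (0 : ℝ) ≤ 40 * d * c := by positivity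
  -- the (214)/(1.125)-hypotheses at `α₄` follow from those at `2α₄`
  have hC4G : 0 ≤ C4G d L := by
    have h6 : (0 : ℝ) ≤ C6 d := by unfold C6; linarith [one_le_C5 (d := d)]
    have h7 : (0 : ℝ) ≤ B7Prop10General.C7 d := by
      unfold B7Prop10General.C7 C6; linarith [one_le_C5 (d := d), C5'_nonneg (d := d)]
    have h4' := C4'_nonneg (d := d)
    unfold C4G; positivity
  have hC6 : (0 : ℝ) ≤ C6 d := by unfold C6; linarith [one_le_C5 (d := d)]
  have hs₁' : 200 * C6 d * α₄ ≤ 1 := by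
    have h1 : 200 * C6 d * α₄ ≤ 200 * C6 d * (2 * α₄) :=
      mul_le_mul_of_nonneg_left (by linarith only [hα₄]) (by positivity)
    exact h1.trans hs₁
  have hs₂' : 12000 * ((d : ℝ) + 1) * L * α₄ ≤ 1 := by
    have h1 : 12000 * ((d : ℝ) + 1) * L * α₄ ≤ 12000 * ((d : ℝ) + 1) * L * (2 * α₄) :=
      mul_le_mul_of_nonneg_left (by linarith only [hα₄]) (by positivity)
    exact h1.trans hs₂
  have hs₃' : C4G d L * (α₀ + 40 * d * c + 4 * α₄) ≤ 1 := by
    have h1 : C4G d L * (α₀ + 40 * d * c + 4 * α₄) ≤ C4G d L * (α₀ + 40 * d * c + 4 * (2 * α₄)) :=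
      mul_le_mul_of_nonneg_left (by linarith only [hα₄]) hC4G
    exact h1.trans hs₃
  -- print's smallness in product form: `C2p·(α₃ + α₄)·B′₀ ≤ 1/8`
  have hprod : C2p d * (40 * d * c + α₄) * B₀' ≤ 1 / 8 := by
    have h1 : (40 * d * c + α₄) * (4 * B₀' * (2 * C2p d)) ≤ 1 := by
      have := mul_le_mul_of_nonneg_right hsm (by positivity : (0 : ℝ) ≤ 4 * B₀' * (2 * C2p d))
      rwa [one_div, inv_mul_cancel₀ (by positivity)] at this
    have e : C2p d * (40 * d * c + α₄) * B₀' = (40 * d * c + α₄) * (4 * B₀' * (2 * C2p d)) / 8 := by ring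
    rw [e]
    linarith only [h1]
  have hquarter : C2p d * B₀' * (40 * d * c + 2 * α₄) ≤ 1 / 4 := by
    have e : C2p d * B₀' * (40 * d * c + 2 * α₄) = 2 * (C2p d * (40 * d * c + α₄) * B₀') - C2p d * B₀' * (40 * d * c) := by
      ring
    have h0 : 0 ≤ C2p d * B₀' * (40 * d * c) := by positivity
    rw [e]
    linarith only [hprod, h0]
  -- the masked family of (1.118) and its uniform bound on the ball
  let F : XSpace d k 𝔸 → (Fin (k + 1) × Site d → 𝔸) := fun X p =>
    if p.2 ∈ Λ p.1 then Cnl L U₀ u₁ p.1 (lam - H' X) p.2 else 0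
  -- (1.120) on every tower, for `X` in the ball
  have hdom : ∀ X : XSpace d k 𝔸, ‖X‖ ≤ α₄ / (2 * B₀') → ∀ j, j ≤ k → ∀ y ∈ Λ j,
      (∀ (x : Site d) (κ : Fin d), InBox (tlo L y j) (thi L y j) x → InBox (tlo L y j) (thi L y j) (x + e κ) →
          ‖cj (U₀ x κ) ((lam - H' X) (x + e κ)) - (lam - H' X) x‖ < α₄ * ((L : ℝ) ^ j)⁻¹) ∧
        ∀ x : Site d, InBox (tlo L y j) (thi L y j) x → ‖(lam - H' X) x‖ < α₄ := fun X hX j hj y hy =>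
    dom120_of_119_tower H' hB (by positivity) hH0 (hH1 j hj y hy) (h119a j hj y hy) (h119b j hj y hy) hX
  -- (1.121) at every point of `𝔅_k`, for `X` in the ball
  have h121 : ∀ X : XSpace d k 𝔸, ‖X‖ ≤ α₄ / (2 * B₀') → ∀ j, j ≤ k → ∀ y ∈ Λ j,
      ‖Cnl L U₀ u₁ j (lam - H' X) y‖ ≤ C2p d * (40 * d * c + α₄) * α₄ := fun X hX j hj y hy =>
    norm_Cnl_le_tower hL hG hU₀ hα hα3 hα4 (h33 j hj y hy) hc (h69 j hj y hy) hsmall hc₃ hs hL1 (hu₁ j hj y hy) hα₄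
      (hdom X hX j hj y hy).2 (hdom X hX j hj y hy).1 hα₃' hs₁' hs₂' hs₃' hs₄ hs₅ hs₆ hs₇
  have hFbound : ∀ X : XSpace d k 𝔸, ‖X‖ ≤ α₄ / (2 * B₀') → ∀ p : Fin (k + 1) × Site d,
      ‖F X p‖ ≤ C2p d * (40 * d * c + α₄) * α₄ := by
    intro X hX p
    simp only [F]
    split_ifs with hp
    · exact h121 X hX p.1 (Nat.le_of_lt_succ p.1.isLt) p.2 hp
    · rw [norm_zero]; positivity
  -- the transformation (1.118) on the `X`-space (packaged where bounded, `0` otherwise — never used there)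
  let T : XSpace d k 𝔸 → XSpace d k 𝔸 := fun X =>
    if h : ∃ C : ℝ, ∀ p, ‖F X p‖ ≤ C then BoundedContinuousFunction.ofNormedAddCommGroupDiscrete (F X) h.choose h.choose_spec
    else 0
  have hT_apply : ∀ X : XSpace d k 𝔸, ‖X‖ ≤ α₄ / (2 * B₀') → ∀ p, T X p = F X p := by
    intro X hX p
    have h : ∃ C : ℝ, ∀ p, ‖F X p‖ ≤ C := ⟨_, hFbound X hX⟩
    simp only [T, dif_pos h]
    rfl
  -- Banach's theorem on the closed ball
  have hle : C2p d * (40 * d * c + α₄) * α₄ ≤ α₄ / (2 * B₀') := by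
    rw [le_div_iff₀ (by positivity)]
    calc C2p d * (40 * d * c + α₄) * α₄ * (2 * B₀') = 2 * α₄ * (C2p d * (40 * d * c + α₄) * B₀') := by ring
      _ ≤ 2 * α₄ * (1 / 8) := mul_le_mul_of_nonneg_left hprod (by positivity)
      _ ≤ α₄ := by linarith only [hα₄]
  have hfix := B8SectDSource.fixedPoint_closedBall T hρ (κ := 1 / 2) (by norm_num) (by norm_num) ?_ ?_
  rotate_left
  · -- self-map
    intro X hX
    refine (BoundedContinuousFunction.norm_le hρ).2 fun p => ?_
    rw [hT_apply X hX p]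
    exact (hFbound X hX p).trans hle
  · -- contraction with constant `½`
    intro X Y hX hY
    refine (BoundedContinuousFunction.norm_le (by positivity)).2 fun p => ?_
    rw [BoundedContinuousFunction.coe_sub, Pi.sub_apply, hT_apply X hX p, hT_apply Y hY p]
    simp only [F]
    split_ifs with hp
    · have h2 : 2 * α₄ / 2 = α₄ := by ring
      obtain ⟨hXa, hXb⟩ := hdom X hX p.1 (Nat.le_of_lt_succ p.1.isLt) p.2 hp
      obtain ⟨hYa, hYb⟩ := hdom Y hY p.1 (Nat.le_of_lt_succ p.1.isLt) p.2 hp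
      have hdiff : lam - H' X - (lam - H' Y) = H' (Y - X) := by rw [map_sub]; abel
      have hma : ∀ (x : Site d) (κ : Fin d), InBox (tlo L p.2 p.1) (thi L p.2 p.1) x →
          InBox (tlo L p.2 p.1) (thi L p.2 p.1) (x + e κ) →
          ‖cj (U₀ x κ) ((lam - H' X - (lam - H' Y)) (x + e κ)) - (lam - H' X - (lam - H' Y)) x‖ ≤
            B₀' * ‖X - Y‖ * ((L : ℝ) ^ (p.1 : ℕ))⁻¹ := fun x κ hx hxe => by
        rw [hdiff, norm_sub_rev X Y]; exact hH1 p.1 (Nat.le_of_lt_succ p.1.isLt) p.2 hp (Y - X) x κ hx hxe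
      have hmb : ∀ x : Site d, InBox (tlo L p.2 p.1) (thi L p.2 p.1) x → ‖(lam - H' X - (lam - H' Y)) x‖ ≤ B₀' * ‖X - Y‖ :=
        fun x _ => by rw [hdiff, norm_sub_rev X Y]; exact hH0 (Y - X) x
      have hlip := lipschitz_Cnl_tower hL hG hU₀ hα hα3 hα4 (h33 p.1 (Nat.le_of_lt_succ p.1.isLt) p.2 hp) hc
        (h69 p.1 (Nat.le_of_lt_succ p.1.isLt) p.2 hp) hsmall hc₃ hs hL1 (hu₁ p.1 (Nat.le_of_lt_succ p.1.isLt) p.2 hp)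
        (by positivity : 0 < 2 * α₄) (by positivity : 0 ≤ B₀' * ‖X - Y‖)
        (fun x hx => by rw [h2]; exact hXb x hx) (fun x κ hx hxe => by rw [h2]; exact hXa x κ hx hxe)
        (fun x hx => by rw [h2]; exact hYb x hx) (fun x κ hx hxe => by rw [h2]; exact hYa x κ hx hxe)
        hmb hma hα₃' hs₁ hs₂ hs₃ hs₄ hs₅ hs₆ hs₇
      have hκ : C2p d * (2 * (B₀' * ‖X - Y‖)) * (40 * d * c + 2 * α₄) ≤ 1 / 2 * ‖X - Y‖ := by
        have hXY := norm_nonneg (X - Y)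
        calc C2p d * (2 * (B₀' * ‖X - Y‖)) * (40 * d * c + 2 * α₄)
            = 2 * ‖X - Y‖ * (C2p d * B₀' * (40 * d * c + 2 * α₄)) := by ring
          _ ≤ 2 * ‖X - Y‖ * (1 / 4) := mul_le_mul_of_nonneg_left hquarter (by positivity)
          _ = 1 / 2 * ‖X - Y‖ := by ring
      exact hlip.trans hκ
    · rw [sub_self, norm_zero]; positivity
  -- read the fixed point of `T` as the pointwise equation (1.117) on `𝔅_k`
  have hequiv : ∀ X : XSpace d k 𝔸, ‖X‖ ≤ α₄ / (2 * B₀') →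
      (T X = X ↔ ∀ (j : ℕ) (hj : j ≤ k) (y : Site d),
        (y ∈ Λ j → X (⟨j, Nat.lt_succ_of_le hj⟩, y) = Cnl L U₀ u₁ j (lam - H' X) y) ∧
          (y ∉ Λ j → X (⟨j, Nat.lt_succ_of_le hj⟩, y) = 0)) := by
    intro X hX
    constructor
    · intro hTX j hj y
      have h : T X (⟨j, Nat.lt_succ_of_le hj⟩, y) = X (⟨j, Nat.lt_succ_of_le hj⟩, y) :=
        congrArg (fun Z : XSpace d k 𝔸 => Z (⟨j, Nat.lt_succ_of_le hj⟩, y)) hTX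
      rw [hT_apply X hX] at h
      simp only [F] at h
      constructor
      · intro hy; rw [if_pos hy] at h; exact h.symm
      · intro hy; rw [if_neg hy] at h; exact h.symm
    · intro hP
      apply BoundedContinuousFunction.ext
      intro p
      rw [hT_apply X hX p]
      simp only [F]
      obtain ⟨h1, h2⟩ := hP p.1 (Nat.le_of_lt_succ p.1.isLt) p.2
      have hp : (⟨(p.1 : ℕ), Nat.lt_succ_of_le (Nat.le_of_lt_succ p.1.isLt)⟩ : Fin (k + 1)) = p.1 := Fin.ext rfl
      rw [hp] at h1 h2
      split_ifs with hy
      · exact (h1 hy).symm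
      · exact (h2 hy).symm
  obtain ⟨X, ⟨hXρ, hXfix⟩, huniq⟩ := hfix
  refine ⟨X, ⟨hXρ, (hequiv X hXρ).1 hXfix⟩, fun Y hY => huniq Y ⟨hY.1, (hequiv Y hY.1).2 hY.2⟩⟩

end FixedPoint

/-! ## §4 (1.114)–(1.116) on `𝔅_k`: the solution linearises `Q′(u₁, ·)` -/

section Eq1114

variable {𝔸 : Type*} [NormedRing 𝔸] [NormedAlgebra ℂ 𝔸] [CompleteSpace 𝔸]

/-- **(1.114) FROM (1.115)–(1.117) ON `𝔅_k`**, the algebra of p. 96 («Q′λ − Q′H′D′(λ) + C′(λ − H′D′(λ)) = Q′λ, (1.115) hence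
−D′(λ) + C′(λ − H′D′(λ)) = 0. (1.116)») read at the points of `𝔅_k` only: if `X` solves (1.117) at every `(j, y ∈ Λ_j)`
(`C′_j(u₁, λ − H′X)(y) = X(j, y)`) and `Q′H′ = I` on `𝔅_k` (`(Q′_j(H′Y))(y) = Y(j, y)` for `y ∈ Λ_j` — (1.91)), then
`Q′_j(u₁, λ − H′X)(y) = (Q′_jλ)(y)` for `y ∈ Λ_j`: the transformation (1.113) `λ′ = λ − H′X` linearises `Q′(u₁, ·)` on `𝔅_k`.
(`Q′_j(u₁, ·) = B8Eq178Averages.Qnl`, `Q′_j = QprimeIter (zdBlocking d L) (bgT L U₀) j`; (213) is the definition of `Cnl`.)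
[cite: Balaban1985RegularSpaces, (1.113)–(1.116) pp.95–96, (1.91) p.91] -/
theorem eq1114_of_fixedPoint_kLevel {L : ℕ} {U₀ : Site d → Fin d → 𝔸ˣ} {u₁ : Site d → 𝔸ˣ} {k : ℕ} (Λ : ℕ → Set (Site d))
    (H' : XSpace d k 𝔸 →ₗ[ℂ] (Site d → 𝔸)) {lam : Site d → 𝔸} {X : XSpace d k 𝔸}
    (hQH : ∀ (Y : XSpace d k 𝔸) (j : ℕ) (hj : j ≤ k) (y : Site d), y ∈ Λ j →
      QprimeIter (zdBlocking d L) (bgT L U₀) j (H' Y) y = Y (⟨j, Nat.lt_succ_of_le hj⟩, y))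
    (hfix : ∀ (j : ℕ) (hj : j ≤ k) (y : Site d), y ∈ Λ j →
      Cnl L U₀ u₁ j (lam - H' X) y = X (⟨j, Nat.lt_succ_of_le hj⟩, y)) :
    ∀ (j : ℕ), j ≤ k → ∀ y ∈ Λ j,
      Qnl L U₀ (fun x => expUnit ((lam - H' X) x)) u₁ j y = QprimeIter (zdBlocking d L) (bgT L U₀) j lam y := by
  intro j hj y hy
  -- (213): `Q′(u₁, μ) = Q′μ + C′(μ)` is the definition of `Cnl`
  have h213 : Qnl L U₀ (fun x => expUnit ((lam - H' X) x)) u₁ j y =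
      QprimeIter (zdBlocking d L) (bgT L U₀) j (lam - H' X) y + Cnl L U₀ u₁ j (lam - H' X) y := by
    rw [Cnl]; abel
  -- linearity of `Q′_j`: `Q′(λ − H′X) = Q′λ − Q′H′X`
  have hlin : QprimeIter (zdBlocking d L) (bgT L U₀) j (lam - H' X) y =
      QprimeIter (zdBlocking d L) (bgT L U₀) j lam y - QprimeIter (zdBlocking d L) (bgT L U₀) j (H' X) y := by
    have h1 : lam - H' X = lam + (-1 : ℂ) • H' X := by rw [neg_one_smul, sub_eq_add_neg]
    rw [h1, QprimeIter_line, neg_one_smul, sub_eq_add_neg]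
  rw [h213, hlin, hQH X j hj y hy, hfix j hj y hy]
  abel

end Eq1114

section Dprime

variable {𝔸 : Type*} [NormedRing 𝔸] [NormOneClass 𝔸] [NormedAlgebra ℂ 𝔸] [CompleteSpace 𝔸]

/-- **«FROM Eq. (1.116) WE CAN GET MUCH BETTER BOUNDS ON IT: |D′(λ)| = |C′(λ − H′D′(λ))| < C′₂(α₃ + α₄)α₄»** (p. 97) AT `k` LEVELS:
any `X` in the ball `‖X‖ ≤ α₄/(2B′₀)` solving (1.117) on `𝔅_k` and vanishing off `𝔅_k` has `‖X‖ ≤ C2p·(α₃ + α₄)·α₄` (`α₃ = 40d·c`),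
under the tower-local hypotheses of `eq1117_existsUnique_kLevel` ((1.121) at every point of `𝔅_k`, `norm_Cnl_le_tower`).
[cite: Balaban1985RegularSpaces, p.97 (sentence after «We take D′(λ) equal to this solution»), (1.116) p.96, (1.121) p.96] -/
theorem norm_Dprime_le_kLevel {L : ℕ} (hL : 2 ≤ L) (hL1 : 1 ≤ L) {G : Subgroup 𝔸ˣ} (hG : AvgClosed d L G)
    {U₀ : Site d → Fin d → 𝔸ˣ} (hU₀ : ∀ x κ, U₀ x κ ∈ G) {k : ℕ} (Λ : ℕ → Set (Site d))
    (H' : XSpace d k 𝔸 →ₗ[ℂ] (Site d → 𝔸)) (lam : Site d → 𝔸) {B : Site d → Fin d → 𝔸} {u₁ : Site d → 𝔸ˣ}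
    {α₀ α₄ c B₀' : ℝ}
    (hα : 0 < α₀) (hα3 : C0 d * α₀ ≤ 1 / 3) (hα4 : 4 * α₀ ≤ c2' d L) (hc : 0 ≤ c) (hα₄ : 0 < α₄) (hB : 0 < B₀')
    (h33 : ∀ j, j ≤ k → ∀ y ∈ Λ j, pdevOn (tlo L y j) (thi L y j) U₀ < α₀ * (((L : ℝ) ^ j)⁻¹) ^ 2)
    (h69 : ∀ j, j ≤ k → ∀ y ∈ Λ j, ∀ (x : Site d) (κ : Fin d), InBox (tlo L y j) (thi L y j) x →
      InBox (tlo L y j) (thi L y j) (x + e κ) → ‖B x κ‖ ≤ c * ((L : ℝ) ^ j)⁻¹)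
    (hu₁ : ∀ j, j ≤ k → ∀ y ∈ Λ j, ∀ x : Site d, tlo L y j ≤ x → x ≤ thi L y j → u₁ x = glev L hL1 U₀ (expCfg B) j 0 x)
    (h119b : ∀ j, j ≤ k → ∀ y ∈ Λ j, ∀ x : Site d, InBox (tlo L y j) (thi L y j) x → ‖lam x‖ < α₄ / 2)
    (h119a : ∀ j, j ≤ k → ∀ y ∈ Λ j, ∀ (x : Site d) (κ : Fin d), InBox (tlo L y j) (thi L y j) x →
      InBox (tlo L y j) (thi L y j) (x + e κ) → ‖cj (U₀ x κ) (lam (x + e κ)) - lam x‖ < α₄ / 2 * ((L : ℝ) ^ j)⁻¹)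
    (hH0 : ∀ (X : XSpace d k 𝔸) (x : Site d), ‖H' X x‖ ≤ B₀' * ‖X‖)
    (hH1 : ∀ j, j ≤ k → ∀ y ∈ Λ j, ∀ (X : XSpace d k 𝔸) (x : Site d) (κ : Fin d), InBox (tlo L y j) (thi L y j) x →
      InBox (tlo L y j) (thi L y j) (x + e κ) → ‖cj (U₀ x κ) (H' X (x + e κ)) - H' X x‖ ≤ B₀' * ‖X‖ * ((L : ℝ) ^ j)⁻¹)
    (hsmall : Real.exp (4 * (800 * ((d : ℝ) + 1) ^ 2 * ((d : ℝ) + 4)) * α₀) * (1 + 8 * (131072 * ((d : ℝ) + 1) ^ 2) * c) ≤ 2)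
    (hc₃ : 2 * c ≤ c3 d L) (hs : 128 * (d : ℝ) * c ≤ 1) (hα₃' : 40 * d * c ≤ 1 / 200)
    (hs₁ : 200 * C6 d * α₄ ≤ 1) (hs₂ : 12000 * ((d : ℝ) + 1) * L * α₄ ≤ 1)
    (hs₃ : C4G d L * (α₀ + 40 * d * c + 4 * α₄) ≤ 1)
    (hs₄ : 1024 * ((d : ℝ) + 1) * ((d : ℝ) + 4) * L ^ 2 * α₀ ≤ 1) (hs₅ : 32 * ((d : ℝ) + 1) ^ 2 * C6 d * L ^ 2 * α₀ ≤ 1)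
    (hs₆ : 16 * d * C5' d * C6 d * (L : ℝ) ^ 2 * α₀ ≤ 1) (hs₇ : 8 * d * C6 d * L * α₀ ≤ 1)
    {X : XSpace d k 𝔸} (hXρ : ‖X‖ ≤ α₄ / (2 * B₀'))
    (hzero : ∀ (j : ℕ) (hj : j ≤ k) (y : Site d), y ∉ Λ j → X (⟨j, Nat.lt_succ_of_le hj⟩, y) = 0)
    (hfix : ∀ (j : ℕ) (hj : j ≤ k) (y : Site d), y ∈ Λ j → Cnl L U₀ u₁ j (lam - H' X) y = X (⟨j, Nat.lt_succ_of_le hj⟩, y)) :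
    ‖X‖ ≤ C2p d * (40 * d * c + α₄) * α₄ := by
  have hC2 : 0 ≤ C2p d := C2p_nonneg d
  refine (BoundedContinuousFunction.norm_le (by positivity)).2 fun p => ?_
  have hp : ((⟨(p.1 : ℕ), Nat.lt_succ_of_le (Nat.le_of_lt_succ p.1.isLt)⟩ : Fin (k + 1)), p.2) = p :=
    Prod.ext (Fin.ext rfl) rfl
  by_cases hy : p.2 ∈ Λ p.1
  · obtain ⟨ha, hb⟩ := dom120_of_119_tower H' hB (by positivity) hH0 (hH1 p.1 (Nat.le_of_lt_succ p.1.isLt) p.2 hy)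
      (h119a p.1 (Nat.le_of_lt_succ p.1.isLt) p.2 hy) (h119b p.1 (Nat.le_of_lt_succ p.1.isLt) p.2 hy) hXρ
    have h := hfix p.1 (Nat.le_of_lt_succ p.1.isLt) p.2 hy
    rw [hp] at h
    rw [← h]
    exact norm_Cnl_le_tower hL hG hU₀ hα hα3 hα4 (h33 p.1 (Nat.le_of_lt_succ p.1.isLt) p.2 hy) hc
      (h69 p.1 (Nat.le_of_lt_succ p.1.isLt) p.2 hy) hsmall hc₃ hs hL1 (hu₁ p.1 (Nat.le_of_lt_succ p.1.isLt) p.2 hy) hα₄ hb ha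
      hα₃' hs₁ hs₂ hs₃ hs₄ hs₅ hs₆ hs₇
  · have h := hzero p.1 (Nat.le_of_lt_succ p.1.isLt) p.2 hy
    rw [hp] at h
    rw [h, norm_zero]
    positivity

/-- **«WE TAKE D′(λ) EQUAL TO THIS SOLUTION» + (1.114) AT `k` LEVELS** (pp. 96–97): under the hypotheses of `eq1117_existsUnique_kLevel` and
`Q′H′ = I` on `𝔅_k` ((1.91)), there is an `X = D′(λ)` with `‖X‖ ≤ α₄/(2B′₀)`, vanishing off `𝔅_k`, solving (1.117) on `𝔅_k`, and such that
«the transformation λ′ = λ − H′D′(λ) (1.113) changes the function Q′(λ′) into the linear function Q′λ» ON `𝔅_k`: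
`Q′_j(u₁, λ − H′X)(y) = (Q′_jλ)(y)` for every `j ≤ k`, `y ∈ Λ_j` — (1.114).
[cite: Balaban1985RegularSpaces, (1.113)–(1.114) p.95, (1.117) p.96, p.97 («We take D′(λ) equal to this solution»)] -/
theorem exists_Dprime_kLevel {L : ℕ} (hL : 2 ≤ L) (hL1 : 1 ≤ L) {G : Subgroup 𝔸ˣ} (hG : AvgClosed d L G)
    {U₀ : Site d → Fin d → 𝔸ˣ} (hU₀ : ∀ x κ, U₀ x κ ∈ G) {k : ℕ} (Λ : ℕ → Set (Site d))
    (H' : XSpace d k 𝔸 →ₗ[ℂ] (Site d → 𝔸)) (lam : Site d → 𝔸) {B : Site d → Fin d → 𝔸} {u₁ : Site d → 𝔸ˣ}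
    {α₀ α₄ c B₀' : ℝ}
    (hα : 0 < α₀) (hα3 : C0 d * α₀ ≤ 1 / 3) (hα4 : 4 * α₀ ≤ c2' d L) (hc : 0 ≤ c) (hα₄ : 0 < α₄) (hB : 0 < B₀')
    (h33 : ∀ j, j ≤ k → ∀ y ∈ Λ j, pdevOn (tlo L y j) (thi L y j) U₀ < α₀ * (((L : ℝ) ^ j)⁻¹) ^ 2)
    (h69 : ∀ j, j ≤ k → ∀ y ∈ Λ j, ∀ (x : Site d) (κ : Fin d), InBox (tlo L y j) (thi L y j) x →
      InBox (tlo L y j) (thi L y j) (x + e κ) → ‖B x κ‖ ≤ c * ((L : ℝ) ^ j)⁻¹)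
    (hu₁ : ∀ j, j ≤ k → ∀ y ∈ Λ j, ∀ x : Site d, tlo L y j ≤ x → x ≤ thi L y j → u₁ x = glev L hL1 U₀ (expCfg B) j 0 x)
    (h119b : ∀ j, j ≤ k → ∀ y ∈ Λ j, ∀ x : Site d, InBox (tlo L y j) (thi L y j) x → ‖lam x‖ < α₄ / 2)
    (h119a : ∀ j, j ≤ k → ∀ y ∈ Λ j, ∀ (x : Site d) (κ : Fin d), InBox (tlo L y j) (thi L y j) x →
      InBox (tlo L y j) (thi L y j) (x + e κ) → ‖cj (U₀ x κ) (lam (x + e κ)) - lam x‖ < α₄ / 2 * ((L : ℝ) ^ j)⁻¹)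
    (hH0 : ∀ (X : XSpace d k 𝔸) (x : Site d), ‖H' X x‖ ≤ B₀' * ‖X‖)
    (hH1 : ∀ j, j ≤ k → ∀ y ∈ Λ j, ∀ (X : XSpace d k 𝔸) (x : Site d) (κ : Fin d), InBox (tlo L y j) (thi L y j) x →
      InBox (tlo L y j) (thi L y j) (x + e κ) → ‖cj (U₀ x κ) (H' X (x + e κ)) - H' X x‖ ≤ B₀' * ‖X‖ * ((L : ℝ) ^ j)⁻¹)
    (hQH : ∀ (Y : XSpace d k 𝔸) (j : ℕ) (hj : j ≤ k) (y : Site d), y ∈ Λ j →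
      QprimeIter (zdBlocking d L) (bgT L U₀) j (H' Y) y = Y (⟨j, Nat.lt_succ_of_le hj⟩, y))
    (hsmall : Real.exp (4 * (800 * ((d : ℝ) + 1) ^ 2 * ((d : ℝ) + 4)) * α₀) * (1 + 8 * (131072 * ((d : ℝ) + 1) ^ 2) * c) ≤ 2)
    (hc₃ : 2 * c ≤ c3 d L) (hs : 128 * (d : ℝ) * c ≤ 1) (hα₃' : 40 * d * c ≤ 1 / 200)
    (hs₁ : 200 * C6 d * (2 * α₄) ≤ 1) (hs₂ : 12000 * ((d : ℝ) + 1) * L * (2 * α₄) ≤ 1)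
    (hs₃ : C4G d L * (α₀ + 40 * d * c + 4 * (2 * α₄)) ≤ 1)
    (hs₄ : 1024 * ((d : ℝ) + 1) * ((d : ℝ) + 4) * L ^ 2 * α₀ ≤ 1) (hs₅ : 32 * ((d : ℝ) + 1) ^ 2 * C6 d * L ^ 2 * α₀ ≤ 1)
    (hs₆ : 16 * d * C5' d * C6 d * (L : ℝ) ^ 2 * α₀ ≤ 1) (hs₇ : 8 * d * C6 d * L * α₀ ≤ 1)
    (hsm : 40 * d * c + α₄ ≤ 1 / (4 * B₀' * (2 * C2p d))) :
    ∃ X : XSpace d k 𝔸, ‖X‖ ≤ α₄ / (2 * B₀') ∧ ‖X‖ ≤ C2p d * (40 * d * c + α₄) * α₄ ∧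
      (∀ (j : ℕ) (hj : j ≤ k) (y : Site d), y ∉ Λ j → X (⟨j, Nat.lt_succ_of_le hj⟩, y) = 0) ∧
      (∀ (j : ℕ) (hj : j ≤ k) (y : Site d), y ∈ Λ j →
        Cnl L U₀ u₁ j (lam - H' X) y = X (⟨j, Nat.lt_succ_of_le hj⟩, y)) ∧
      ∀ (j : ℕ), j ≤ k → ∀ y ∈ Λ j,
        Qnl L U₀ (fun x => expUnit ((lam - H' X) x)) u₁ j y = QprimeIter (zdBlocking d L) (bgT L U₀) j lam y := by
  obtain ⟨X, ⟨hXρ, hXfix⟩, -⟩ := eq1117_existsUnique_kLevel hL hL1 hG hU₀ Λ H' lam hα hα3 hα4 hc hα₄ hB h33 h69 hu₁ h119b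
    h119a hH0 hH1 hsmall hc₃ hs hα₃' hs₁ hs₂ hs₃ hs₄ hs₅ hs₆ hs₇ hsm
  have hfix : ∀ (j : ℕ) (hj : j ≤ k) (y : Site d), y ∈ Λ j → Cnl L U₀ u₁ j (lam - H' X) y = X (⟨j, Nat.lt_succ_of_le hj⟩, y) :=
    fun j hj y hy => ((hXfix j hj y).1 hy).symm
  have hzero : ∀ (j : ℕ) (hj : j ≤ k) (y : Site d), y ∉ Λ j → X (⟨j, Nat.lt_succ_of_le hj⟩, y) = 0 :=
    fun j hj y hy => (hXfix j hj y).2 hy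
  -- the smallness at `α₄` from the one at `2α₄`
  have hC6 : (0 : ℝ) ≤ C6 d := by unfold C6; linarith [one_le_C5 (d := d)]
  have hC4G : 0 ≤ C4G d L := by
    have h7 : (0 : ℝ) ≤ B7Prop10General.C7 d := by
      unfold B7Prop10General.C7 C6; linarith [one_le_C5 (d := d), C5'_nonneg (d := d)]
    have h4' := C4'_nonneg (d := d)
    unfold C4G; positivity
  have hs₁' : 200 * C6 d * α₄ ≤ 1 :=
    (mul_le_mul_of_nonneg_left (by linarith only [hα₄]) (by positivity)).trans hs₁
  have hs₂' : 12000 * ((d : ℝ) + 1) * L * α₄ ≤ 1 :=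
    (mul_le_mul_of_nonneg_left (by linarith only [hα₄]) (by positivity)).trans hs₂
  have hs₃' : C4G d L * (α₀ + 40 * d * c + 4 * α₄) ≤ 1 :=
    (mul_le_mul_of_nonneg_left (by linarith only [hα₄]) hC4G).trans hs₃
  have hbd := norm_Dprime_le_kLevel hL hL1 hG hU₀ Λ H' lam hα hα3 hα4 hc hα₄ hB h33 h69 hu₁ h119b h119a hH0 hH1 hsmall hc₃ hs
    hα₃' hs₁' hs₂' hs₃' hs₄ hs₅ hs₆ hs₇ hXρ hzero hfix
  exact ⟨X, hXρ, hbd, hzero, hfix, eq1114_of_fixedPoint_kLevel Λ H' hQH hfix⟩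

end Dprime

/-! ## §5 The same for THE inductive `u₁`: the hypothesis `u₁ = glev_j on Bʲ(Λ_j)` from (1.19)/(1.29) (dag-n04-b's `eq106_of_inAx_restr129`) -/

section Axial

variable {𝔸 : Type*} [NormedRing 𝔸] [NormOneClass 𝔸] [NormedAlgebra ℂ 𝔸] [CompleteSpace 𝔸]

omit [NormOneClass 𝔸] in
/-- «`u₁` … is determined uniquely in terms of `U₁` and is given by (106)» (p. 88) in the form this file consumes: if `U₁^{u₁}U₀ ∈
Ax_k(𝔅_k, U₀)` ((1.19), `InAx`) and `u₁` satisfies (1.29) (`Restr129`), then `u₁ = glev_j` on every tower `Bʲ(y)`, `y ∈ Λ_j`, `j ≤ k`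
(dag-n04-b's `B8Eq106Local.eq106_of_inAx_restr129`, rewritten from `Under` to the tower box).
[cite: Balaban1985RegularSpaces, p.88 (sentence after (1.69)), (1.19) p.79, (1.29) p.81; Balaban1985Averaging, (106) p.33] -/
theorem glev_on_towers_of_axial {L : ℕ} (hL1 : 1 ≤ L) {k : ℕ} (Λ : ℕ → Set (Site d)) {U₀ : Site d → Fin d → 𝔸ˣ}
    {B : Site d → Fin d → 𝔸} {u₁ : Site d → 𝔸ˣ}
    (hAx : InAx L k Λ U₀ (mgauge U₀ u₁ (expCfg B) * U₀)) (h129 : Restr129 L k Λ U₀ u₁) :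
    ∀ j, j ≤ k → ∀ y ∈ Λ j, ∀ x : Site d, tlo L y j ≤ x → x ≤ thi L y j → u₁ x = glev L hL1 U₀ (expCfg B) j 0 x :=
  fun _ hj _ hy x hx hx' =>
    eq106_of_inAx_restr129 L hL1 k Λ U₀ (expCfg B) u₁ hAx h129 hj hy x ((under_iff_tower L _ _ x).2 ⟨hx, hx'⟩)

/-- **`D′(λ)` AND (1.114) AT `k` LEVELS FOR THE INDUCTIVE `u₁` OF THEOREM 4** — `exists_Dprime_kLevel` with the hypothesis
`u₁ = glev_j on Bʲ(Λ_j)` DISCHARGED from the typed classes of B8: `U₁^{u₁}U₀ ∈ Ax_k(𝔅_k, U₀)` ((1.19)/(1.34), `InAx`) and (1.29) for `u₁`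
(`Restr129`; for the inductive `u₁` this is (1.68)).  Everything else as there (tower-local (1.33)/(1.69)/(1.119)/H′-modulus, `Q′H′ = I` on
`𝔅_k`, `j`-free smallness). [cite: Balaban1985RegularSpaces, (1.113)–(1.121) pp.95–97, (1.68)–(1.69) p.88, (1.19) p.79, (1.29) p.81] -/
theorem exists_Dprime_kLevel_of_axial {L : ℕ} (hL : 2 ≤ L) (hL1 : 1 ≤ L) {G : Subgroup 𝔸ˣ} (hG : AvgClosed d L G)
    {U₀ : Site d → Fin d → 𝔸ˣ} (hU₀ : ∀ x κ, U₀ x κ ∈ G) {k : ℕ} (Λ : ℕ → Set (Site d))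
    (H' : XSpace d k 𝔸 →ₗ[ℂ] (Site d → 𝔸)) (lam : Site d → 𝔸) {B : Site d → Fin d → 𝔸} {u₁ : Site d → 𝔸ˣ}
    {α₀ α₄ c B₀' : ℝ}
    (hα : 0 < α₀) (hα3 : C0 d * α₀ ≤ 1 / 3) (hα4 : 4 * α₀ ≤ c2' d L) (hc : 0 ≤ c) (hα₄ : 0 < α₄) (hB : 0 < B₀')
    (h33 : ∀ j, j ≤ k → ∀ y ∈ Λ j, pdevOn (tlo L y j) (thi L y j) U₀ < α₀ * (((L : ℝ) ^ j)⁻¹) ^ 2)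
    (h69 : ∀ j, j ≤ k → ∀ y ∈ Λ j, ∀ (x : Site d) (κ : Fin d), InBox (tlo L y j) (thi L y j) x →
      InBox (tlo L y j) (thi L y j) (x + e κ) → ‖B x κ‖ ≤ c * ((L : ℝ) ^ j)⁻¹)
    (hAx : InAx L k Λ U₀ (mgauge U₀ u₁ (expCfg B) * U₀)) (h129 : Restr129 L k Λ U₀ u₁)
    (h119b : ∀ j, j ≤ k → ∀ y ∈ Λ j, ∀ x : Site d, InBox (tlo L y j) (thi L y j) x → ‖lam x‖ < α₄ / 2)
    (h119a : ∀ j, j ≤ k → ∀ y ∈ Λ j, ∀ (x : Site d) (κ : Fin d), InBox (tlo L y j) (thi L y j) x →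
      InBox (tlo L y j) (thi L y j) (x + e κ) → ‖cj (U₀ x κ) (lam (x + e κ)) - lam x‖ < α₄ / 2 * ((L : ℝ) ^ j)⁻¹)
    (hH0 : ∀ (X : XSpace d k 𝔸) (x : Site d), ‖H' X x‖ ≤ B₀' * ‖X‖)
    (hH1 : ∀ j, j ≤ k → ∀ y ∈ Λ j, ∀ (X : XSpace d k 𝔸) (x : Site d) (κ : Fin d), InBox (tlo L y j) (thi L y j) x →
      InBox (tlo L y j) (thi L y j) (x + e κ) → ‖cj (U₀ x κ) (H' X (x + e κ)) - H' X x‖ ≤ B₀' * ‖X‖ * ((L : ℝ) ^ j)⁻¹)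
    (hQH : ∀ (Y : XSpace d k 𝔸) (j : ℕ) (hj : j ≤ k) (y : Site d), y ∈ Λ j →
      QprimeIter (zdBlocking d L) (bgT L U₀) j (H' Y) y = Y (⟨j, Nat.lt_succ_of_le hj⟩, y))
    (hsmall : Real.exp (4 * (800 * ((d : ℝ) + 1) ^ 2 * ((d : ℝ) + 4)) * α₀) * (1 + 8 * (131072 * ((d : ℝ) + 1) ^ 2) * c) ≤ 2)
    (hc₃ : 2 * c ≤ c3 d L) (hs : 128 * (d : ℝ) * c ≤ 1) (hα₃' : 40 * d * c ≤ 1 / 200)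
    (hs₁ : 200 * C6 d * (2 * α₄) ≤ 1) (hs₂ : 12000 * ((d : ℝ) + 1) * L * (2 * α₄) ≤ 1)
    (hs₃ : C4G d L * (α₀ + 40 * d * c + 4 * (2 * α₄)) ≤ 1)
    (hs₄ : 1024 * ((d : ℝ) + 1) * ((d : ℝ) + 4) * L ^ 2 * α₀ ≤ 1) (hs₅ : 32 * ((d : ℝ) + 1) ^ 2 * C6 d * L ^ 2 * α₀ ≤ 1)
    (hs₆ : 16 * d * C5' d * C6 d * (L : ℝ) ^ 2 * α₀ ≤ 1) (hs₇ : 8 * d * C6 d * L * α₀ ≤ 1)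
    (hsm : 40 * d * c + α₄ ≤ 1 / (4 * B₀' * (2 * C2p d))) :
    ∃ X : XSpace d k 𝔸, ‖X‖ ≤ α₄ / (2 * B₀') ∧ ‖X‖ ≤ C2p d * (40 * d * c + α₄) * α₄ ∧
      (∀ (j : ℕ) (hj : j ≤ k) (y : Site d), y ∉ Λ j → X (⟨j, Nat.lt_succ_of_le hj⟩, y) = 0) ∧
      (∀ (j : ℕ) (hj : j ≤ k) (y : Site d), y ∈ Λ j →
        Cnl L U₀ u₁ j (lam - H' X) y = X (⟨j, Nat.lt_succ_of_le hj⟩, y)) ∧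
      ∀ (j : ℕ), j ≤ k → ∀ y ∈ Λ j,
        Qnl L U₀ (fun x => expUnit ((lam - H' X) x)) u₁ j y = QprimeIter (zdBlocking d L) (bgT L U₀) j lam y :=
  exists_Dprime_kLevel hL hL1 hG hU₀ Λ H' lam hα hα3 hα4 hc hα₄ hB h33 h69 (glev_on_towers_of_axial hL1 Λ hAx h129) h119b h119a hH0
    hH1 hQH hsmall hc₃ hs hα₃' hs₁ hs₂ hs₃ hs₄ hs₅ hs₆ hs₇ hsm

end Axial

#print axioms norm_Cnl_le_tower
#print axioms lipschitz_Cnl_tower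
#print axioms eq1117_existsUnique_kLevel
#print axioms eq1114_of_fixedPoint_kLevel
#print axioms norm_Dprime_le_kLevel
#print axioms exists_Dprime_kLevel
#print axioms exists_Dprime_kLevel_of_axial

end Literature.MathematicalPhysics.QuantumFieldTheory.Balaban1983to89.B8Eq1117KLevel

end
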